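import Mathlib
import Summits.PneNP.PneNP.Theorems.RamseyNotNP.Negative.ComplementSymmetry
import Literature.Computability.Complexity.KarpLipton
import Literature.Computability.Complexity.NPClosureProofs
import Literature.Computability.MetaComplexity.ProofSystems
import Literature.Computability.MetaComplexity.ProofSystemsProofs

/-!
# Crux `RamseyNotNP` (stmt-PneNP-9814) — EXEMPT-46 re-examination (strategist r1): the (a)/(b)/(c) ledger, kernel-checked parts

Companion certificate of `Cruxes/RamseyNotNP/STRATEGY-CENSUS.md` v3, PART 0 (seat
planner-cstrat-stmt-PneNP-9814-r1-0, 2026-08-17).  X := `Summit.PneNP.PneNP.Theses.RamseyUncertifiable.RamseyNotNP`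
(RAMSEY₂ ∉ NP), S := `PneNP`.

The BC2-redirect exemption asks for pieces `X₁ … X_k` with (a) each load-bearing, (b) a PROVED, NON-TRIVIAL
assembly `X₁ ∧ … ∧ X_k → X`, (c) no piece equivalent to X or (at least) S.  This file proves the constraints
that every candidate in the census table obeys:

* §1 `piece_summit_given_partner`: from ANY assembly `W → C → X`, each piece is summit-strength GIVEN the
  other (`C → W → S`).  Hence (c) can only mean "the piece ALONE, with landed theorems"; and
  `piece_summit_of_partner_proved`: once the partner lands, the survivor is ≥ S — the Sketch failure mode is the
  generic end state of every two-piece split at `k_open = 1` (so a qualifying split needs k_open ≥ 2 NOW).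
* §2 `NP_subset_P_of_not_pneNP`, `sigmaTwo_eq`, `polyExists_coNP_subset_NP_of_not_pneNP`,
  **`summit_of_sigmaTwo_not_NP`** (Σ₂-CAP): for every `L ∈ ∃ᵖ·coNP = Σ₂ᵖ`, the piece "`L ∉ NP`" implies S.
* §3 `guess_and_certify` (+ `guess_and_certify_ramsey`): under `¬X` an NP machine may GUESS Ramsey
  super-objects and have them certified — `∃ᵖ·K ⊆ NP` for every class `K` that `¬X` puts inside NP, in
  particular `∃ᵖ·{RAMSEY₂}`; and `ramsey_polyExists_subset_sigmaTwo`: all such languages are Σ₂ᵖ.  Together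
  with §2: every "completion / guess-a-Ramsey-witness" split (census D.11–D.12) has a contentful assembly (b ✓)
  and a summit-strength computational piece (c ✗).
* §4 `cases_split_iff`, `cases_piece_strength`: the proof-by-cases split `(A → X) ∧ (¬A → X)` is exact, its
  assembly is `by_cases` (b ✗), and each piece is a conditional form of X (≥ `A → S`).
* §4b the natural instance `A := ExistsOpt` ("an optimal Ramsey certifier exists") is pure costume:
  `cases_existsOpt_second : ¬ExistsOpt → X` is a THEOREM (a p-bounded certifier is optimal) and
  `cases_existsOpt_first_iff : (ExistsOpt → X) ↔ X` — one half proved, the other X itself (c ✗, kernel iff).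
* §5 `amplifier_cut`: any (weakening, amplifier) split whose amplifier is literally `¬X → ¬W` assembles in
  one line (b ✗) — the fixed-exponent/speed-up cut (census S.9/D.9) and the re-basing cuts have this shape.
* §6 `generic_cut` (ideator 5's optimality cut, language-generic, re-proved to QUOTE ITS LENGTH for (b)):
  `Hard Q → Opt Q → L ∉ NP` is three tactic lines for EVERY language `L` — a definitional seam.
* §7 typability of the completion pieces: `RamseyNotNPc c` (RAMSEY^{(c)} ∉ NP, threshold ⌈c·log₂ n⌉ =
  `Nat.clog 2 (n ^ c)`), `RamseyCompletion c` (every such graph is INDUCED in a threshold-Ramsey graph `H`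
  with `|H|² ≤ n^c`); sanity `ramseyNotNPc_two` (c = 2 is X, `Iff.rfl`) and `ramseyCompletion_two` (c = 2
  holds with `H := G`).  The reduction `RamseyNotNPc c → RamseyCompletion c → X` (guess `H` and the
  embedding, certify `H`) is proved on paper in the census (D.11) and NOT kernel-checked here.

0 `sorry`.  `band`, `not_ramseyNotNP_of_not_pneNP`, `pneNP_of_ramseyNotNP` are re-proved from the landed
Negative lemmas exactly as in `WallBreakerCertificate.lean` (strategist p1; Cruxes files are not importable
modules); `generic_cut` follows ideator 5's `SketchIdeator5.ramseyNotNP_of_hard_opt` (credited).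
-/

-- `Summit.PneNP.PneNP.…` duplicates `PneNP` BY DESIGN (single-problem summit, D-0017).
set_option linter.dupNamespace false

namespace Summit.PneNP.PneNP.Cruxes.RamseyNotNP.ReExam

open Literature.Computability.Complexity Literature.Computability.Complexity.Nondeterministic
open Literature.Computability.MetaComplexity
open Summit.PneNP.PneNP.Theses.RamseyUncertifiable (RamseyNotNP RamseyInCoNP closes)
open Summit.PneNP.PneNP.Theorems.RamseyNotNP.Negative

/-! ## §0 The spine (as in `WallBreakerCertificate.lean`) -/

/-- The summit's failure refutes the crux: `¬PneNP → RAMSEY₂ ∈ P ⊆ NP`. [folklore] -/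
theorem not_ramseyNotNP_of_not_pneNP (h : ¬ PneNP) : ¬ RamseyNotNP :=
  fun hX => hX (P_subset_NP_holds (ramseyLang_thr_mem_P_of_not_pneNP h))

/-- The crux proves the summit (landed `closes` + `ramseyInCoNP_proof`). [folklore] -/
theorem pneNP_of_ramseyNotNP (hX : RamseyNotNP) : PneNP :=
  closes hX Summit.PneNP.PneNP.Theorems.ramseyInCoNP_proof

/-- BAND LEMMA (strategist p1): a conjunct implied by the summit's failure forces a summit-strength
partner. [folklore] -/
theorem band {A B : Prop} (hB : ¬ PneNP → B) (hcut : A → B → RamseyNotNP) : A → PneNP :=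
  fun a => Classical.byContradiction fun hs => not_ramseyNotNP_of_not_pneNP hs (hcut a (hB hs))

/-- Dual: a conjunct REFUTED by the summit's failure is itself summit-strength. [folklore] -/
theorem summit_of_collapse_refuted {W : Prop} (hW : ¬ PneNP → ¬ W) : W → PneNP :=
  fun w => Classical.byContradiction fun hs => hW hs w

/-! ## §1 Criterion (c) is about a piece ALONE: every piece is summit-strength given its partner -/

/-- From ANY two-piece assembly, each piece implies the summit GIVEN the other piece. [folklore] -/
theorem piece_summit_given_partner {W C : Prop} (hcut : W → C → RamseyNotNP) : C → W → PneNP :=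
  fun c w => pneNP_of_ramseyNotNP (hcut w c)

/-- … so once one piece is PROVED, the survivor is ≥ S (the Sketch end state, `k_open = 1`). [folklore] -/
theorem piece_summit_of_partner_proved {W C : Prop} (hC : C) (hcut : W → C → RamseyNotNP) : W → PneNP :=
  piece_summit_given_partner hcut hC

/-- Symmetric form. [folklore] -/
theorem piece_summit_given_partner' {W C : Prop} (hcut : W → C → RamseyNotNP) : W → C → PneNP :=
  fun w c => pneNP_of_ramseyNotNP (hcut w c)

/-! ## §2 `NP ⊆ P` under the collapse, and the Σ₂-cap -/

/-- `¬PneNP → NP ⊆ P` (`NP = co coNP`, landed `coNP_eq_P_of_not_pneNP`, `co P = P`). [folklore] -/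
theorem NP_subset_P_of_not_pneNP (h : ¬ PneNP) : Nondeterministic.NP ⊆ Classes.P := by
  have h1 : coNP = Classes.P := coNP_eq_P_of_not_pneNP h
  have h2 : Nondeterministic.NP = co coNP := by
    show Nondeterministic.NP = co (co Nondeterministic.NP)
    rw [co_co]
  rw [h2, h1, co_P_holds]

/-- `Σ₂ᵖ = ∃ᵖ·coNP` (`Σ₂ = ∃ᵖ·Π₁`, `Π₁ = coNP`). [folklore] -/
theorem sigmaTwo_eq : SigmaP 2 = polyExists coNP := by
  have hpi : PiP 1 = coNP := PiP_one_holds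
  rw [show (2 : ℕ) = 1 + 1 from rfl, SigmaP_succ, hpi]

/-- `∃ᵖ·NP ⊆ NP` (merging two existential blocks; tree `KarpLipton.polyExists_SigmaP_succ_subset` at
level 1 with `Σ₁ = NP`). [folklore] -/
theorem polyExists_NP_subset_NP : polyExists Nondeterministic.NP ⊆ Nondeterministic.NP := by
  have h : polyExists (SigmaP 1) ⊆ SigmaP 1 := KarpLipton.polyExists_SigmaP_succ_subset 0
  have e : SigmaP 1 = Nondeterministic.NP := SigmaP_one_holds
  rwa [e] at h

/-- Under the collapse `∃ᵖ·coNP ⊆ P`. [folklore] -/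
theorem polyExists_coNP_subset_P_of_not_pneNP (h : ¬ PneNP) : polyExists coNP ⊆ Classes.P := by
  intro L hL
  have h1 : coNP = Classes.P := coNP_eq_P_of_not_pneNP h
  rw [h1] at hL
  -- `polyExists P` is `NP` by definition
  exact NP_subset_P_of_not_pneNP h hL

/-- Under the collapse `Σ₂ᵖ = ∃ᵖ·coNP ⊆ NP`. [folklore] -/
theorem polyExists_coNP_subset_NP_of_not_pneNP (h : ¬ PneNP) :
    polyExists coNP ⊆ Nondeterministic.NP :=
  fun _ hL => P_subset_NP_holds (polyExists_coNP_subset_P_of_not_pneNP h hL)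

/-- **Σ₂-CAP.** For every language `L ∈ ∃ᵖ·coNP` (= Σ₂ᵖ), the statement "`L ∉ NP`" is refuted by the
summit's failure, hence is SUMMIT-STRENGTH as a piece: it fails criterion (c) no matter what its partner
is.  This caps every "guess-and-certify" split (§3): the languages a Ramsey certifier would put into NP by
guessing Ramsey super-objects are all Σ₂ᵖ. [folklore] -/
theorem summit_of_sigmaTwo_not_NP {L : Language Bool} (hL : L ∈ polyExists coNP) :
    L ∉ Nondeterministic.NP → PneNP :=
  summit_of_collapse_refuted fun hs hW => hW (polyExists_coNP_subset_NP_of_not_pneNP hs hL)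

/-- Same, stated at level `Σ₂ᵖ`. [folklore] -/
theorem summit_of_sigmaTwo_not_NP' {L : Language Bool} (hL : L ∈ SigmaP 2) :
    L ∉ Nondeterministic.NP → PneNP :=
  summit_of_sigmaTwo_not_NP (sigmaTwo_eq ▸ hL)

/-! ## §3 Guess-and-certify: what a Ramsey certifier buys, and why it is capped -/

/-- **Guess-and-certify.** If the crux fails, every class `K` that the certifier puts inside NP has
`∃ᵖ·K ⊆ NP`: an NP machine may GUESS a polynomial-size object and have the certifier vouch for it — no
explicit construction is needed (this is how nondeterminism evades the explicit-construction wall B1 of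
the census). [folklore] -/
theorem guess_and_certify {K : Set (Language Bool)} (hK : ¬ RamseyNotNP → K ⊆ Nondeterministic.NP)
    (hX : ¬ RamseyNotNP) : polyExists K ⊆ Nondeterministic.NP :=
  fun _ hL => polyExists_NP_subset_NP (polyExists_mono (hK hX) hL)

/-- Instance: `¬X → ∃ᵖ·{RAMSEY₂} ⊆ NP`. [folklore] -/
theorem guess_and_certify_ramsey (hX : ¬ RamseyNotNP) :
    polyExists {ramseyLangAt thr} ⊆ Nondeterministic.NP :=
  guess_and_certify (fun h => by
    intro L hL
    rw [Set.mem_singleton_iff.1 hL]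
    exact not_ramseyNotNP_iff.1 h) hX

/-- … and unconditionally `∃ᵖ·{RAMSEY₂} ⊆ ∃ᵖ·coNP = Σ₂ᵖ` (RAMSEY₂ ∈ coNP is landed). [folklore] -/
theorem ramsey_polyExists_subset_sigmaTwo : polyExists {ramseyLangAt thr} ⊆ polyExists coNP :=
  polyExists_mono fun L hL => by
    rw [Set.mem_singleton_iff.1 hL]
    exact ramseyLang_thr_mem_coNP

/-- Hence every split "`(L ∉ NP) ∧ C → X`" whose computational piece names a language of
`∃ᵖ·{RAMSEY₂}` (a completion / guessed-witness language) has a summit-strength piece: (c) fails. [folklore] -/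
theorem completionSplit_piece_summit {L : Language Bool} (hL : L ∈ polyExists {ramseyLangAt thr}) :
    L ∉ Nondeterministic.NP → PneNP :=
  summit_of_sigmaTwo_not_NP (ramsey_polyExists_subset_sigmaTwo hL)

/-! ## §4 The proof-by-cases split -/

/-- `X ↔ (A → X) ∧ (¬A → X)` for every `A`: exact, and the assembly is `by_cases` — a trivial seam (b ✗).
[folklore] -/
theorem cases_split_iff (A : Prop) : ((A → RamseyNotNP) ∧ (¬ A → RamseyNotNP)) ↔ RamseyNotNP := by
  constructor
  · rintro ⟨h₁, h₂⟩
    by_cases a : A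
    · exact h₁ a
    · exact h₂ a
  · exact fun h => ⟨fun _ => h, fun _ => h⟩

/-- Each half is a conditional form of X and is ≥ the conditional summit `A → S`. [folklore] -/
theorem cases_piece_strength {A : Prop} (h : A → RamseyNotNP) : A → PneNP :=
  fun a => pneNP_of_ramseyNotNP (h a)

/-- If the case hypothesis is decided in the tree, one half alone is X (costume). [folklore] -/
theorem cases_piece_of_decided {A : Prop} (ha : A) (h : A → RamseyNotNP) : RamseyNotNP := h ha

/-! ## §4b The natural instance of the cases split is pure costume: `A := "an optimal Ramsey certifier exists"` -/

/-- Evaluation of an `ℕ`-polynomial is monotone (ideator 5 / strategist p1, copied). [folklore] -/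
private theorem eval_mono (r : Polynomial ℕ) {a b : ℕ} (hab : a ≤ b) : r.eval a ≤ r.eval b := by
  rw [Polynomial.eval_eq_sum_range, Polynomial.eval_eq_sum_range]
  exact Finset.sum_le_sum fun i _ => Nat.mul_le_mul_left _ (Nat.pow_le_pow_left hab i)

/-- A polynomially bounded proof system for `L` simulates every proof system for `L` (ideator 5's
`opt_of_isPolyBounded`, language-generic; copied from `WallBreakerCertificate.lean`). [folklore] -/
theorem simulates_of_isPolyBounded {L : Language Bool} {Q W : List Bool → List Bool → Bool}
    (hQ : IsProofSystemFor Q L) (hb : IsPolyBounded Q) (hW : IsProofSystemFor W L) :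
    Simulates Q W := by
  obtain ⟨p, hp⟩ := hb
  refine ⟨p, fun x π hπ => ?_⟩
  have hx : x ∈ L := (hW.2 x).2 ⟨π, hπ⟩
  obtain ⟨π₀, hπ₀⟩ := (hQ.2 x).1 hx
  obtain ⟨π', hlen, hacc⟩ := hp x π₀ hπ₀
  exact ⟨π', hlen.trans (eval_mono p (Nat.le_add_right _ _)), hacc⟩

/-- "Some optimal Ramsey certifier exists" (Krajíček 2019, Problem 1.5.5 for RAMSEY₂). -/
def ExistsOpt : Prop :=
  ∃ Q, IsProofSystemFor Q (ramseyLangAt thr) ∧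
    ∀ W, IsProofSystemFor W (ramseyLangAt thr) → Simulates Q W

/-- If the crux FAILS, an optimal certifier exists (the p-bounded one; no collapse needed). [folklore] -/
theorem existsOpt_of_not_ramseyNotNP (hX : ¬ RamseyNotNP) : ExistsOpt := by
  obtain ⟨Q, hQ, hb⟩ :=
    (hasPolyBoundedProofSystem_iff_mem_NP_holds (L := ramseyLangAt thr)).2 (not_ramseyNotNP_iff.1 hX)
  exact ⟨Q, hQ, fun W hW => simulates_of_isPolyBounded hQ hb hW⟩

/-- Hence the second half of the cases split on `ExistsOpt` is a THEOREM … [folklore] -/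
theorem cases_existsOpt_second : ¬ ExistsOpt → RamseyNotNP :=
  fun hno => Classical.byContradiction fun hX => hno (existsOpt_of_not_ramseyNotNP hX)

/-- … and the first half is EQUIVALENT to the crux: `(ExistsOpt → X) ↔ X` (ideator 5's dichotomy
"X ⟺ every optimal certifier is hard", in cases form).  So the split `(ExistsOpt → X) ∧ (¬ExistsOpt → X)`
is (X-equivalent) ∧ (theorem): criterion (c) fails by a kernel-checked iff. [folklore] -/
theorem cases_existsOpt_first_iff : (ExistsOpt → RamseyNotNP) ↔ RamseyNotNP := by
  constructor
  · intro h
    by_cases hX : RamseyNotNP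
    · exact hX
    · exact h (existsOpt_of_not_ramseyNotNP hX)
  · exact fun hX _ => hX

/-! ## §5 (weakening, amplifier) splits whose amplifier is an implication assemble in one line -/

/-- `W ∧ (¬X → ¬W) → X` — the shape of the fixed-exponent/speed-up cut (`W := RAMSEY₂ ∉ NTIME(N^c)`,
amplifier `RAMSEY₂ ∈ NP → RAMSEY₂ ∈ NTIME(N^c)`) and of every re-basing cut: modus tollens (b ✗). [folklore] -/
theorem amplifier_cut {W : Prop} (hw : W) (hamp : ¬ RamseyNotNP → ¬ W) : RamseyNotNP :=
  Classical.byContradiction fun hx => hamp hx hw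

/-- And the amplifier of such a cut is X-or-¬W: `(¬X → ¬W) ↔ (X ∨ ¬W)`. [folklore] -/
theorem amplifier_iff_or (W : Prop) : (¬ RamseyNotNP → ¬ W) ↔ (RamseyNotNP ∨ ¬ W) := by
  constructor
  · intro h
    by_cases hx : RamseyNotNP
    · exact Or.inl hx
    · exact Or.inr (h hx)
  · rintro (hx | hw) hnx
    · exact absurd hx hnx
    · exact hw

/-! ## §6 The optimality cut is language-generic and three lines long -/

/-- **Generic cut** (ideator 5's `ramseyNotNP_of_hard_opt`, for an ARBITRARY language `L`): a proof
system `Q` for `L` that is not polynomially bounded but simulates every proof system for `L` puts `L`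
outside NP.  Three tactic lines, no property of `L` used — the (b) evidence for census row D.2. [folklore] -/
theorem generic_cut {L : Language Bool} {Q : List Bool → List Bool → Bool}
    (hQ : IsProofSystemFor Q L) (hH : ¬ IsPolyBounded Q)
    (hO : ∀ W, IsProofSystemFor W L → Simulates Q W) : L ∉ Nondeterministic.NP := by
  intro hNP
  obtain ⟨W, hW, hWb⟩ := (hasPolyBoundedProofSystem_iff_mem_NP_holds (L := L)).2 hNP
  exact hH (IsPolyBounded.of_simulates_holds (hO W hW) hWb hQ hW)

/-- The cut instantiated at RAMSEY₂ (= `SketchIdeator5.ramseyNotNP_of_hard_opt`). [folklore] -/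
theorem optimality_cut {Q : List Bool → List Bool → Bool}
    (hQ : IsProofSystemFor Q (ramseyLangAt thr)) (hH : ¬ IsPolyBounded Q)
    (hO : ∀ W, IsProofSystemFor W (ramseyLangAt thr) → Simulates Q W) : RamseyNotNP :=
  generic_cut hQ hH hO

/-! ## §7 The completion pieces are typable; c = 2 sanity -/

/-- RAMSEY^{(c)} ∉ NP: the two-sided language at threshold `⌈c·log₂ n⌉ = Nat.clog 2 (n ^ c)` is not in NP
(the disprover's `RamseyNotNPAt` at that threshold).  For every `c` this language is in coNP (homogeneous
set as witness, the `RamseyInCoNP` template), so the statement is ≥ coNP ≠ NP ≥ S: (c) fails on paper;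
kernel-checked for c = 2 only (`ramseyNotNPc_two` + landed sandwich). -/
def RamseyNotNPc (c : ℕ) : Prop := RamseyNotNPAt fun n => Nat.clog 2 (n ^ c)

/-- RAMSEY COMPLETION at exponent `c`: eventually, every graph on `n` vertices with no homogeneous set of
size `⌈c·log₂ n⌉` is an INDUCED subgraph of a threshold-Ramsey graph `H` on `m` vertices with `n ≤ m` and
`m² ≤ n^c` (so `⌈2 log₂ m⌉ ≤ ⌈c log₂ n⌉`: Ramsey-ness of `H` certifies the bound for `G`).  Pure
combinatorics; open for c > 2 (random one-shot extension fails when `G` has ≳ m homogeneous (t−1)-sets). -/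
def RamseyCompletion (c : ℕ) : Prop :=
  ∃ n₀ : ℕ, ∀ n ≥ n₀, ∀ G : SimpleGraph (Fin n),
    G.CliqueFree (Nat.clog 2 (n ^ c)) → Gᶜ.CliqueFree (Nat.clog 2 (n ^ c)) →
      ∃ m : ℕ, n ≤ m ∧ m ^ 2 ≤ n ^ c ∧ ∃ H : SimpleGraph (Fin m),
        (H.CliqueFree (thr m) ∧ Hᶜ.CliqueFree (thr m)) ∧ Nonempty (G ↪g H)

/-- c = 2 is the crux itself. [folklore] -/
theorem ramseyNotNPc_two : RamseyNotNPc 2 ↔ RamseyNotNP := Iff.rfl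

/-- c = 2 completion is trivial (`H := G`): the definitions compute. [folklore] -/
theorem ramseyCompletion_two : RamseyCompletion 2 :=
  ⟨0, fun n _ G h₁ h₂ => ⟨n, le_rfl, le_rfl, G, ⟨h₁, h₂⟩, ⟨SimpleGraph.Embedding.refl⟩⟩⟩

/-- The completion cut as a Prop (paper proof in the census, D.11; not kernel-checked): guess `H` and the
embedding, certify `H`. Recorded so that the census row names a typed statement. -/
def CompletionCut (c : ℕ) : Prop := RamseyNotNPc c → RamseyCompletion c → RamseyNotNP

/-- At c = 2 the cut is trivially valid (first piece is X). [folklore] -/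
theorem completionCut_two : CompletionCut 2 := fun h _ => h

end Summit.PneNP.PneNP.Cruxes.RamseyNotNP.ReExam
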